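import Summits.Ventures.PercRepro.SingleMergeSeven

/-!
# Lemma B on eight coordinates reduces to a pure 8-point code bound

In a three-type single-merge map on eight coordinates every crossing point is a 4-set
(`four_le_card_openEdges_of_crossing` for it and its antipode), crossing points of different cells
meet in at most two coordinates (`card_inter_add_two_le`), antipodes have different cells, and all
three cell pairs occur. So the crossing points form a **code**: a complement-closed family of
4-subsets of an 8-element set, 3-coloured with complements of different colours, different colours
meeting in `≤ 2` points, all three colour pairs present. `CodeBound8` says such a code has at most
18 members. Since `topBotCount c ≥ |S| + 1 = 9` (`card_add_one_le_topBotCount`) and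
`|code| = 2·crossCount`, the bound gives `crossCount ≤ 9 ≤ topBotCount`
(`crossCount_le_topBotCount_of_card_eq_eight`); maps with fewer than three types are covered by
the column lemma. Hence Lemma B for every single-merge map on at most eight coordinates, and
C-005 for every multigraph with at most eight edges, follow from `CodeBound8`
(`crossCount_le_topBotCount_of_card_le_eight`).

`CodeBound8` is a finite statement with no percolation content. For `Fin 8` it is UNSAT-certified
(kissat, `HOME/mining/p4/g4/gen_code8.py`, job j158711, 54 s: no such code has 20 members; the
18-member codes exist, e.g. the crossing points of the kissat map j158380). It is NOT proved here.
-/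

namespace PercRepro

open Finset

/-- **The 8-point code bound** (finite combinatorial statement, not proved here; kissat-certified
for `Fin 8`): a complement-closed family of 4-subsets of an 8-element type, 3-coloured so that
complements have different colours, members of different colours meet in at most two points, and
every pair of distinct colours occurs on some complementary pair, has at most 18 members. -/
def CodeBound8 : Prop :=
  ∀ (α : Type) [Fintype α] [DecidableEq α], Fintype.card α = 8 →
    ∀ (C : Finset (Finset α)) (cl : Finset α → Fin 3),
      (∀ σ ∈ C, σ.card = 4) → (∀ σ ∈ C, σᶜ ∈ C) → (∀ σ ∈ C, cl σᶜ ≠ cl σ) →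
      (∀ σ ∈ C, ∀ τ ∈ C, cl σ ≠ cl τ → (σ ∩ τ).card ≤ 2) →
      (∀ i j : Fin 3, i ≠ j → ∃ σ ∈ C, cl σ = i ∧ cl σᶜ = j) → C.card ≤ 18

/-- **The code bound on `Fin 8`** — exactly the instance certified by kissat (j158711: no such code
with 20 members). -/
def CodeBound8Fin : Prop :=
  ∀ (C : Finset (Finset (Fin 8))) (cl : Finset (Fin 8) → Fin 3),
    (∀ σ ∈ C, σ.card = 4) → (∀ σ ∈ C, σᶜ ∈ C) → (∀ σ ∈ C, cl σᶜ ≠ cl σ) →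
    (∀ σ ∈ C, ∀ τ ∈ C, cl σ ≠ cl τ → (σ ∩ τ).card ≤ 2) →
    (∀ i j : Fin 3, i ≠ j → ∃ σ ∈ C, cl σ = i ∧ cl σᶜ = j) → C.card ≤ 18

section Transport

variable {α β : Type} [Fintype α] [DecidableEq α] [Fintype β] [DecidableEq β]

/-- Complements transport along an equivalence. -/
theorem map_equiv_compl (e : α ≃ β) (σ : Finset α) :
    (σ.map e.toEmbedding)ᶜ = σᶜ.map e.toEmbedding := by
  ext x
  rw [Finset.mem_compl, Finset.mem_map_equiv, Finset.mem_map_equiv, Finset.mem_compl]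

omit [Fintype α] [DecidableEq α] [Fintype β] [DecidableEq β] in
/-- Mapping forth and back is the identity. -/
theorem map_equiv_symm_map (e : α ≃ β) (σ : Finset α) :
    (σ.map e.toEmbedding).map e.symm.toEmbedding = σ := by
  ext x
  rw [Finset.mem_map_equiv, Finset.mem_map_equiv]
  simp

end Transport

/-- **The `Fin 8` instance implies the general bound** (transport along `Fintype.equivFinOfCardEq`). -/
theorem codeBound8_of_fin (h : CodeBound8Fin) : CodeBound8 := by
  intro α _ _ h8 C cl h4 hcompl hne hinter h3
  classical
  let e : α ≃ Fin 8 := Fintype.equivFinOfCardEq h8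
  let C' : Finset (Finset (Fin 8)) := C.image fun σ => σ.map e.toEmbedding
  let cl' : Finset (Fin 8) → Fin 3 := fun τ => cl (τ.map e.symm.toEmbedding)
  have hmem : ∀ τ, τ ∈ C' ↔ ∃ σ ∈ C, σ.map e.toEmbedding = τ := by
    intro τ; simp only [C', Finset.mem_image]
  have hcl' : ∀ σ, cl' (σ.map e.toEmbedding) = cl σ := by
    intro σ; show cl ((σ.map e.toEmbedding).map e.symm.toEmbedding) = cl σ
    rw [map_equiv_symm_map]
  have hcard' : C'.card = C.card :=
    Finset.card_image_of_injective _ (Finset.map_injective e.toEmbedding)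
  rw [← hcard']
  refine h C' cl' ?_ ?_ ?_ ?_ ?_
  · intro τ hτ
    obtain ⟨σ, hσ, rfl⟩ := (hmem τ).1 hτ
    rw [Finset.card_map]; exact h4 σ hσ
  · intro τ hτ
    obtain ⟨σ, hσ, rfl⟩ := (hmem τ).1 hτ
    rw [map_equiv_compl, hmem]
    exact ⟨σᶜ, hcompl σ hσ, rfl⟩
  · intro τ hτ
    obtain ⟨σ, hσ, rfl⟩ := (hmem τ).1 hτ
    rw [map_equiv_compl, hcl', hcl']
    exact hne σ hσ
  · intro τ hτ τ' hτ' hcc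
    obtain ⟨σ, hσ, rfl⟩ := (hmem τ).1 hτ
    obtain ⟨σ', hσ', rfl⟩ := (hmem τ').1 hτ'
    rw [hcl', hcl'] at hcc
    rw [← Finset.map_inter, Finset.card_map]
    exact hinter σ hσ σ' hσ' hcc
  · intro i j hij
    obtain ⟨σ, hσ, h1, h2⟩ := h3 i j hij
    refine ⟨σ.map e.toEmbedding, (hmem _).2 ⟨σ, hσ, rfl⟩, ?_, ?_⟩
    · rw [hcl']; exact h1
    · rw [map_equiv_compl, hcl']; exact h2

section Eight

variable {S : Type} [Fintype S] [DecidableEq S]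

/-- The configuration whose open coordinates are exactly `σ`. -/
def configOf (σ : Finset S) : Config S := fun e => decide (e ∈ σ)

/-- The open edges of the configuration of a finset are that finset. -/
theorem openEdges_configOf (σ : Finset S) : openEdges (configOf σ) = σ := by
  ext e; simp [mem_openEdges, configOf]

/-- The configuration of the open edges of `ω` is `ω`. -/
theorem configOf_openEdges (ω : Config S) : configOf (openEdges ω) = ω := by
  funext e; simp only [configOf, mem_openEdges]; cases ω e <;> simp

/-- Lemma B when fewer than three crossing-pair types occur (one cell meets every crossing pair). -/
theorem crossCount_le_topBotCount_of_not_threeTypes (c : Config S → Setoid (Fin 4))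
    (hc : Monotone c) (h3 : ¬ ThreeTypes c) : crossCount cross4 c ≤ topBotCount c := by
  classical
  obtain ⟨i, j, hij, hno⟩ : ∃ i j : Fin 3, i ≠ j ∧
      ∀ ω : Config S, ¬ (c ω = cross4 i ∧ c ωᶜ = cross4 j) := by
    by_contra hcon
    apply h3
    intro i j hij
    by_contra hne
    exact hcon ⟨i, j, hij, fun ω hω => hne ⟨ω, hω⟩⟩
  have key : ∀ i j : Fin 3, i ≠ j → ∃ k : Fin 3, k ≠ i ∧ k ≠ j := by decide
  obtain ⟨k, hki, hkj⟩ := key i j hij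
  refine crossCount_le_topBotCount_of_column cross4 c cross4_isCrossingFamily hc k ?_
  intro a b hak hbk
  rw [Finset.eq_empty_iff_forall_notMem]
  intro ω hω
  rw [mem_crossFam] at hω
  obtain ⟨hab, h1, h2⟩ := hω
  have key2 : ∀ a b i j k : Fin 3, i ≠ j → k ≠ i → k ≠ j → a ≠ k → b ≠ k → a ≠ b →
      (a = i ∧ b = j) ∨ (a = j ∧ b = i) := by decide
  have hcases := key2 a b i j k hij hki hkj hak hbk hab
  rcases hcases with ⟨rfl, rfl⟩ | ⟨rfl, rfl⟩
  · exact hno ω ⟨h1, h2⟩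
  · exact hno ωᶜ ⟨h2, by rw [compl_compl]; exact h1⟩

/-- **Lemma B on eight coordinates from the code bound.** -/
theorem crossCount_le_topBotCount_of_card_eq_eight (hcode : CodeBound8)
    (c : Config S → Setoid (Fin 4)) (hc : Monotone c) (hsm : SingleMergeMap c)
    (h8 : Fintype.card S = 8) : crossCount cross4 c ≤ topBotCount c := by
  classical
  by_cases h3 : ThreeTypes c
  · have hg : 9 ≤ topBotCount c := by
      have := card_add_one_le_topBotCount c hc hsm h3; omega
    -- every crossing point and its antipode are 4-sets
    have hfour : ∀ ω ∈ badMembers cross4 c, (openEdges ω).card = 4 := by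
      intro ω hω
      simp only [badMembers, Finset.mem_filter, Finset.mem_univ, true_and] at hω
      obtain ⟨i, j, hij, h1, h2⟩ := hω
      have ha := four_le_card_openEdges_of_crossing c hc hsm h3 hij h1 h2
      have hb := four_le_card_openEdges_of_crossing c hc hsm h3 (Ne.symm hij) h2
        (by rw [compl_compl]; exact h1)
      rw [openEdges_compl] at hb
      have hsum := Finset.card_add_card_compl (openEdges ω)
      omega
    -- the code: the open-coordinate sets of the crossing points, coloured by their cells
    set B := badMembers cross4 c with hB
    set C : Finset (Finset S) := B.image openEdges with hC
    set cl : Finset S → Fin 3 := fun σ => cellColour cross4 c (configOf σ) with hcl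
    have hmemC : ∀ σ, σ ∈ C ↔ ∃ ω ∈ B, openEdges ω = σ := by
      intro σ; rw [hC, Finset.mem_image]
    have hcardC : C.card = B.card := by
      rw [hC]
      exact Finset.card_image_of_injOn fun ω _ ω' _ h => config_eq_of_openEdges_eq h
    have hBmem : ∀ ω, ω ∈ B ↔ ∃ i j : Fin 3, i ≠ j ∧ c ω = cross4 i ∧ c ωᶜ = cross4 j := by
      intro ω; rw [hB]; simp only [badMembers, Finset.mem_filter, Finset.mem_univ, true_and]
    have hcl_eq : ∀ ω (i : Fin 3), c ω = cross4 i → cl (openEdges ω) = i := by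
      intro ω i hi
      show cellColour cross4 c (configOf (openEdges ω)) = i
      rw [configOf_openEdges]
      exact cellColour_eq cross4 c cross4_injective hi
    have hbound := hcode S h8 C cl ?_ ?_ ?_ ?_ ?_
    · rw [hcardC, hB, card_badMembers cross4 c cross4_injective] at hbound
      omega
    · -- 4-sets
      intro σ hσ
      obtain ⟨ω, hω, rfl⟩ := (hmemC σ).1 hσ
      exact hfour ω hω
    · -- complement-closed
      intro σ hσ
      obtain ⟨ω, hω, rfl⟩ := (hmemC _).1 hσ
      rw [hmemC]
      exact ⟨ωᶜ, compl_mem_badMembers cross4 c hω, openEdges_compl ω⟩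
    · -- complements have different colours
      intro σ hσ
      obtain ⟨ω, hω, rfl⟩ := (hmemC _).1 hσ
      obtain ⟨i, j, hij, h1, h2⟩ := (hBmem ω).1 hω
      rw [← openEdges_compl, hcl_eq ω i h1, hcl_eq ωᶜ j h2]
      exact hij.symm
    · -- different colours meet in at most two coordinates
      intro σ hσ τ hτ hne
      obtain ⟨ω, hω, rfl⟩ := (hmemC _).1 hσ
      obtain ⟨ω', hω', rfl⟩ := (hmemC _).1 hτ
      obtain ⟨i, j, hij, h1, -⟩ := (hBmem ω).1 hω
      obtain ⟨i', j', hij', h1', -⟩ := (hBmem ω').1 hω'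
      rw [hcl_eq ω i h1, hcl_eq ω' i' h1'] at hne
      have := card_inter_add_two_le c hc hsm hne h1 h1'
      rw [← openEdges_inf] at this ⊢
      have h4 := hfour ω hω
      omega
    · -- all three colour pairs occur
      intro i j hij
      obtain ⟨ω, h1, h2⟩ := h3 i j hij
      refine ⟨openEdges ω, (hmemC _).2 ⟨ω, (hBmem ω).2 ⟨i, j, hij, h1, h2⟩, rfl⟩, hcl_eq ω i h1, ?_⟩
      rw [← openEdges_compl]
      exact hcl_eq ωᶜ j h2
  · exact crossCount_le_topBotCount_of_not_threeTypes c hc h3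

/-- **The code bound at dimension `d`** (the general shape of `CodeBound8`): a complement-closed
family of subsets of a `d`-element type, each member and its complement with at least four
elements, 3-coloured so that complements have different colours, members of different colours
meeting in at most `|σ| − 2` and at most `|τ| − 2` points, and every pair of distinct colours
occurring on some complementary pair, has at most `2 · B` members. (`CodeBoundAt 8 9` follows from
`CodeBound8`; the SAT frontier at `d = 9` is the value of the least such `B`.) -/
def CodeBoundAt (d B : ℕ) : Prop :=
  ∀ (α : Type) [Fintype α] [DecidableEq α], Fintype.card α = d →
    ∀ (C : Finset (Finset α)) (cl : Finset α → Fin 3),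
      (∀ σ ∈ C, 4 ≤ σ.card ∧ 4 ≤ σᶜ.card) → (∀ σ ∈ C, σᶜ ∈ C) → (∀ σ ∈ C, cl σᶜ ≠ cl σ) →
      (∀ σ ∈ C, ∀ τ ∈ C, cl σ ≠ cl τ → (σ ∩ τ).card + 2 ≤ σ.card ∧ (σ ∩ τ).card + 2 ≤ τ.card) →
      (∀ i j : Fin 3, i ≠ j → ∃ σ ∈ C, cl σ = i ∧ cl σᶜ = j) → C.card ≤ 2 * B

/-- **Lemma B on `d` coordinates from a code bound `B ≤ d + 1`.** -/
theorem crossCount_le_topBotCount_of_codeBoundAt {d B : ℕ} (hcode : CodeBoundAt d B)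
    (hB : B ≤ d + 1) (c : Config S → Setoid (Fin 4)) (hc : Monotone c) (hsm : SingleMergeMap c)
    (hS : Fintype.card S = d) : crossCount cross4 c ≤ topBotCount c := by
  classical
  by_cases h3 : ThreeTypes c
  · have hg : d + 1 ≤ topBotCount c := by
      have := card_add_one_le_topBotCount c hc hsm h3; omega
    set B' := badMembers cross4 c with hB'
    set C : Finset (Finset S) := B'.image openEdges with hC
    set cl : Finset S → Fin 3 := fun σ => cellColour cross4 c (configOf σ) with hcl
    have hmemC : ∀ σ, σ ∈ C ↔ ∃ ω ∈ B', openEdges ω = σ := by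
      intro σ; rw [hC, Finset.mem_image]
    have hcardC : C.card = B'.card := by
      rw [hC]
      exact Finset.card_image_of_injOn fun ω _ ω' _ h => config_eq_of_openEdges_eq h
    have hBmem : ∀ ω, ω ∈ B' ↔ ∃ i j : Fin 3, i ≠ j ∧ c ω = cross4 i ∧ c ωᶜ = cross4 j := by
      intro ω; rw [hB']; simp only [badMembers, Finset.mem_filter, Finset.mem_univ, true_and]
    have hcl_eq : ∀ ω (i : Fin 3), c ω = cross4 i → cl (openEdges ω) = i := by
      intro ω i hi
      show cellColour cross4 c (configOf (openEdges ω)) = i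
      rw [configOf_openEdges]
      exact cellColour_eq cross4 c cross4_injective hi
    have hbound := hcode S hS C cl ?_ ?_ ?_ ?_ ?_
    · rw [hcardC, hB', card_badMembers cross4 c cross4_injective] at hbound
      omega
    · intro σ hσ
      obtain ⟨ω, hω, rfl⟩ := (hmemC σ).1 hσ
      obtain ⟨i, j, hij, h1, h2⟩ := (hBmem ω).1 hω
      refine ⟨four_le_card_openEdges_of_crossing c hc hsm h3 hij h1 h2, ?_⟩
      rw [← openEdges_compl]
      exact four_le_card_openEdges_of_crossing c hc hsm h3 (Ne.symm hij) h2
        (by rw [compl_compl]; exact h1)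
    · intro σ hσ
      obtain ⟨ω, hω, rfl⟩ := (hmemC _).1 hσ
      rw [hmemC]
      exact ⟨ωᶜ, compl_mem_badMembers cross4 c hω, openEdges_compl ω⟩
    · intro σ hσ
      obtain ⟨ω, hω, rfl⟩ := (hmemC _).1 hσ
      obtain ⟨i, j, hij, h1, h2⟩ := (hBmem ω).1 hω
      rw [← openEdges_compl, hcl_eq ω i h1, hcl_eq ωᶜ j h2]
      exact hij.symm
    · intro σ hσ τ hτ hne
      obtain ⟨ω, hω, rfl⟩ := (hmemC _).1 hσ
      obtain ⟨ω', hω', rfl⟩ := (hmemC _).1 hτ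
      obtain ⟨i, j, hij, h1, -⟩ := (hBmem ω).1 hω
      obtain ⟨i', j', hij', h1', -⟩ := (hBmem ω').1 hω'
      rw [hcl_eq ω i h1, hcl_eq ω' i' h1'] at hne
      have hA := card_inter_add_two_le c hc hsm hne h1 h1'
      have hB2 := card_inter_add_two_le c hc hsm (Ne.symm hne) h1' h1
      rw [← openEdges_inf] at hA hB2 ⊢
      rw [inf_comm] at hB2
      exact ⟨hA, hB2⟩
    · intro i j hij
      obtain ⟨ω, h1, h2⟩ := h3 i j hij
      refine ⟨openEdges ω, (hmemC _).2 ⟨ω, (hBmem ω).2 ⟨i, j, hij, h1, h2⟩, rfl⟩, hcl_eq ω i h1, ?_⟩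
      rw [← openEdges_compl]
      exact hcl_eq ωᶜ j h2
  · exact crossCount_le_topBotCount_of_not_threeTypes c hc h3

/-- `CodeBound8` is the case `d = 8`, `B = 9` of `CodeBoundAt` (members and complements with
`≥ 4` elements out of 8 are exactly the 4-sets). -/
theorem codeBoundAt_eight_of_codeBound8 (h : CodeBound8) : CodeBoundAt 8 9 := by
  intro α _ _ h8 C cl hsz hcompl hne hinter h3
  refine h α h8 C cl ?_ hcompl hne ?_ h3
  · intro σ hσ
    obtain ⟨h1, h2⟩ := hsz σ hσ
    have := Finset.card_add_card_compl σ
    omega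
  · intro σ hσ τ hτ hcc
    have := hinter σ hσ τ hτ hcc
    have h4 := (hsz σ hσ).1
    have h4' : σ.card = 4 := by
      have := Finset.card_add_card_compl σ; have := (hsz σ hσ).2; omega
    omega

/-- **Lemma B for single-merge maps on at most eight coordinates**, given the code bound. -/
theorem crossCount_le_topBotCount_of_card_le_eight (hcode : CodeBound8)
    (c : Config S → Setoid (Fin 4)) (hc : Monotone c) (hsm : SingleMergeMap c)
    (h8 : Fintype.card S ≤ 8) : crossCount cross4 c ≤ topBotCount c := by
  rcases Nat.lt_or_ge (Fintype.card S) 8 with h | h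
  · exact crossCount_le_topBotCount_of_card_le_seven c hc hsm (by omega)
  · exact crossCount_le_topBotCount_of_card_eq_eight hcode c hc hsm (by omega)

end Eight

end PercRepro
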